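import Summits.Parity.GeneralizedHardyLittlewood.Theses.LiouvilleMAD
import HarnessLib.Audit.CruxProbe

/-! BC7/BC2 probe (strategist r1): tautology batteries + `C → S` / `S → C` for the crux
`LiouvilleMAD.CosetDecorrelation` (stmt-Parity-13317). -/

set_option h21.cruxProbe.batteryMs 90000

#h21_crux_probe Summit.Parity.GeneralizedHardyLittlewood.Theses.LiouvilleMAD.CosetDecorrelation route := "route-Parity-LiouvilleMAD"
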